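import Mathlib
import HarnessLib
import Literature.Computability.AlgebraicComplexity.HessianRank
import Summits.PneNP.PneNP.Theorems.CnfIdealGenLengthRankDefectRepresentationsCutLemmaCharacterCuts

/-!
# Crux `RankDefectRepresentations` (stmt-PneNP-18923), line `rank-dehn-ladder`, stub `stub_cutLemma`: PRODUCT TWISTS ARE CHEAP

Setting of the registered negative rung `stub_cutLemma`: rows `x : ι` and columns `y : ι'` carry cube colours
`row x, col y : Fin n → Bool`; the `j`-th coordinate cut of `R` is `X_j = R ∘ 1[row_j ≠ col_j]`, of rank `t_j`.

Second structural rung of the lead's analysis (`Lines/rank-dehn-ladder-briefs.md` §Lead; the first is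
`…CutLemmaCharacterCuts`): for EVERY product function `F(c) = ∏_{l ∈ T} f_l(c_l)` of the colour bits (`f_l : Bool → K`
arbitrary — zeros allowed, no characteristic assumption) the "product twist" `(F(row x) − F(col y)) · R x y` has rank at most
`∑_{j∈T} t_j` (`rank_productTwist_le`).  Characters are the case `f_l = (1, −1)`; the new content is that `R` is an
approximate intertwiner, in the rank metric, for the whole TORUS of diagonal product weights, uniformly with the same budget.
Consequences (`rank_submatrix_productSeparated_le`, `rank_submatrix_layerSeparated_le`): a colour-disjoint rectangle whose
column colours lie on one level set `{F = c}` of a product function avoided by its row colours has rank `≤ ∑ t_j`; in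
particular WEIGHT-LAYER separated rectangles (row colours of `T`-weight `k`, column colours of `T`-weight `l`, some `λ` with
`λ^k ≠ λ^l`) cost at most `∑_{j∈T} t_j` — a class not separated by any character when `k ≡ l (mod 2)`.
Proof: exact identity `M_{T∪{j}} = D_{f_j(row_j)} · M_T + D_{f_j(row_j) − f_j(¬row_j)} · X_j · D_{F_T(col)}` and induction on `T`.
HONEST FRAMING: a tool lemma on the Negative/ lane of the crux; P ≠ NP is not moved; F-N2 is a FRONTIER formal rung.
-/

set_option linter.dupNamespace false -- `Summit.PneNP.PneNP.…`: summit = sub-problem name (D-0017)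

namespace Summit.PneNP.PneNP.Theorems.CnfIdealGenLengthRankDefectRepresentationsCutLemmaProductCuts

open Finset Matrix

variable {K : Type*} [Field K] {n : ℕ} {ι ι' : Type*} [Fintype ι] [Fintype ι'] [DecidableEq ι] [DecidableEq ι']

/-- One telescoping step, as an exact matrix identity: with `F_T(c) = ∏_{l∈T} f_l(c_l)` and `j ∉ T`,
`(F_{T∪j}(row) − F_{T∪j}(col)) ∘ R = D_{f_j(row_j)} ((F_T(row) − F_T(col)) ∘ R) + D_{f_j(row_j) − f_j(¬row_j)} X_j D_{F_T(col)}`.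
[folklore] -/
theorem productTwist_insert (f : Fin n → Bool → K) (row : ι → Fin n → Bool) (col : ι' → Fin n → Bool)
    (R : Matrix ι ι' K) (T : Finset (Fin n)) (j : Fin n) (hj : j ∉ T) :
    (Matrix.of fun x y =>
        ((∏ l ∈ insert j T, f l (row x l)) - ∏ l ∈ insert j T, f l (col y l)) * R x y) =
      Matrix.diagonal (fun x => f j (row x j)) *
          (Matrix.of fun x y => ((∏ l ∈ T, f l (row x l)) - ∏ l ∈ T, f l (col y l)) * R x y) +
        Matrix.diagonal (fun x => f j (row x j) - f j (!row x j)) *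
          (Matrix.of fun x y => if row x j ≠ col y j then R x y else 0) *
          Matrix.diagonal (fun y => ∏ l ∈ T, f l (col y l)) := by
  classical
  ext x y
  simp only [Matrix.add_apply, Matrix.of_apply, Matrix.diagonal_mul, Matrix.mul_diagonal]
  rw [Finset.prod_insert hj, Finset.prod_insert hj]
  by_cases h : row x j ≠ col y j
  · rw [if_pos h]
    have hc : col y j = !row x j := by
      cases hr : row x j <;> cases hc : col y j <;> simp_all
    rw [hc]
    ring
  · rw [if_neg h]
    have h' : row x j = col y j := by simpa using h
    rw [← h']
    ring

/-- **Product twists are cheap.** For every set `T` of coordinates and every family `f_l : Bool → K`, the matrix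
`((∏_{l∈T} f_l(row_l)) − (∏_{l∈T} f_l(col_l))) · R` has rank at most `∑_{j∈T} rank X_j`: `R` almost intertwines the diagonal
product weights on rows and columns, uniformly over the whole torus of weights, with the cut budget.  Uniform in the field.
(Lead analysis of `stub_cutLemma`, rung (C).) [folklore] -/
theorem rank_productTwist_le (f : Fin n → Bool → K) (row : ι → Fin n → Bool) (col : ι' → Fin n → Bool)
    (R : Matrix ι ι' K) (T : Finset (Fin n)) :
    (Matrix.of fun x y => ((∏ l ∈ T, f l (row x l)) - ∏ l ∈ T, f l (col y l)) * R x y).rank ≤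
      ∑ j ∈ T, (Matrix.of fun x y => if row x j ≠ col y j then R x y else 0).rank := by
  classical
  induction T using Finset.induction_on with
  | empty =>
    have : (Matrix.of fun x y => ((∏ l ∈ (∅ : Finset (Fin n)), f l (row x l)) -
        ∏ l ∈ (∅ : Finset (Fin n)), f l (col y l)) * R x y) = (0 : Matrix ι ι' K) := by
      ext x y; simp
    rw [this, Matrix.rank_zero, Finset.sum_empty]
  | insert j T hj ih =>
    rw [productTwist_insert f row col R T j hj, Finset.sum_insert hj]
    have h1 := Literature.Computability.AlgebraicComplexity.rank_add_le
      (Matrix.diagonal (fun x => f j (row x j)) *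
          (Matrix.of fun x y => ((∏ l ∈ T, f l (row x l)) - ∏ l ∈ T, f l (col y l)) * R x y))
      (Matrix.diagonal (fun x => f j (row x j) - f j (!row x j)) *
          (Matrix.of fun x y => if row x j ≠ col y j then R x y else 0) *
          Matrix.diagonal (fun y => ∏ l ∈ T, f l (col y l)))
    have h2 : (Matrix.diagonal (fun x => f j (row x j)) *
          (Matrix.of fun x y => ((∏ l ∈ T, f l (row x l)) - ∏ l ∈ T, f l (col y l)) * R x y)).rank ≤
        (Matrix.of fun x y => ((∏ l ∈ T, f l (row x l)) - ∏ l ∈ T, f l (col y l)) * R x y).rank :=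
      Matrix.rank_mul_le_right _ _
    have h3 : (Matrix.diagonal (fun x => f j (row x j) - f j (!row x j)) *
          (Matrix.of fun x y => if row x j ≠ col y j then R x y else 0) *
          Matrix.diagonal (fun y => ∏ l ∈ T, f l (col y l))).rank ≤
        (Matrix.of fun x y => if row x j ≠ col y j then R x y else 0).rank :=
      (Matrix.rank_mul_le_left _ _).trans (Matrix.rank_mul_le_right _ _)
    omega

/-- **Product-separated rectangles are cheap.** If a product function `F = ∏_{l∈T} f_l` of the colour bits is CONSTANT
(`= c`) on the column colours of a rectangle and avoids `c` on its row colours, the rectangle has rank at most `∑_{j∈T} t_j`: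
it is a row-rescaled submatrix of the product twist.  (Characters `f_l = (1,−1)` recover character-separated rectangles;
coordinate separation is `T = {j}`, `f_j = (1,0)`.) [folklore] -/
theorem rank_submatrix_productSeparated_le {κ κ' : Type*} [Fintype κ] [Fintype κ'] [DecidableEq κ']
    (f : Fin n → Bool → K) (row : ι → Fin n → Bool) (col : ι' → Fin n → Bool) (R : Matrix ι ι' K)
    (T : Finset (Fin n)) (g : κ → ι) (h : κ' → ι') (c : K)
    (hcol : ∀ b, ∏ l ∈ T, f l (col (h b) l) = c) (hrow : ∀ a, ∏ l ∈ T, f l (row (g a) l) ≠ c) :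
    (R.submatrix g h).rank ≤ ∑ j ∈ T, (Matrix.of fun x y => if row x j ≠ col y j then R x y else 0).rank := by
  classical
  set M : Matrix ι ι' K :=
    Matrix.of fun x y => ((∏ l ∈ T, f l (row x l)) - ∏ l ∈ T, f l (col y l)) * R x y with hM
  -- the rectangle is a row-rescaling of the corresponding submatrix of the twist
  have hsub : R.submatrix g h =
      Matrix.diagonal (fun a => ((∏ l ∈ T, f l (row (g a) l)) - c)⁻¹) * M.submatrix g h := by
    ext a b
    simp only [Matrix.submatrix_apply, Matrix.diagonal_mul, hM, Matrix.of_apply, hcol b]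
    rw [← mul_assoc, inv_mul_cancel₀ (sub_ne_zero.mpr (hrow a)), one_mul]
  rw [hsub]
  exact (Matrix.rank_mul_le_right _ _).trans
    ((CnfIdealGenLengthRankDefectRepresentationsCutLemmaCharacterCuts.rank_submatrix_le' M g h).trans
      (rank_productTwist_le f row col R T))

/-- **Weight-layer separated rectangles are cheap.** If every row colour has exactly `k` ones on `T`, every column colour has
exactly `l` ones on `T`, and the field has an element `λ` with `λ^k ≠ λ^l`, the rectangle has rank at most `∑_{j∈T} t_j`
(product function `f_l = (1, λ)`, `F(c) = λ^{#ones}`).  For `k ≡ l (mod 2)` such rectangles are separated by NO character.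
[folklore] -/
theorem rank_submatrix_layerSeparated_le {κ κ' : Type*} [Fintype κ] [Fintype κ'] [DecidableEq κ']
    (row : ι → Fin n → Bool) (col : ι' → Fin n → Bool) (R : Matrix ι ι' K) (T : Finset (Fin n))
    (g : κ → ι) (h : κ' → ι') (k l : ℕ) (lam : K) (hlam : lam ^ k ≠ lam ^ l)
    (hrow : ∀ a, (T.filter fun j => row (g a) j).card = k) (hcol : ∀ b, (T.filter fun j => col (h b) j).card = l) :
    (R.submatrix g h).rank ≤ ∑ j ∈ T, (Matrix.of fun x y => if row x j ≠ col y j then R x y else 0).rank := by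
  classical
  have key : ∀ cc : Fin n → Bool, ∏ j ∈ T, (fun (_ : Fin n) (b : Bool) => if b then lam else (1 : K)) j (cc j) =
      lam ^ (T.filter fun j => cc j).card := by
    intro cc
    simp only []
    rw [Finset.prod_ite, Finset.prod_const_one, mul_one, Finset.prod_const]
  refine rank_submatrix_productSeparated_le (fun _ b => if b then lam else 1) row col R T g h (lam ^ l) ?_ ?_
  · intro b; rw [key, hcol b]
  · intro a; rw [key, hrow a]; exact hlam

end Summit.PneNP.PneNP.Theorems.CnfIdealGenLengthRankDefectRepresentationsCutLemmaProductCuts
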